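import Literature.NumberTheory.FaltingsSerre.GaloisCertificate
import Literature.NumberTheory.FaltingsSerre.FormGaloisRepTwoAdic
import HarnessLib

/-!
# Instance template with the form side CITED: paramodularity of `A` of odd prime level `N` from the
# Galois half of a certificate, the residual identification datum, and the Euler data

[BPPTVY] = A. Brumer, A. Pacetti, C. Poor, G. Tornaría, J. Voight, D. S. Yuen, *On the paramodularity of
typical abelian surfaces*, Algebra & Number Theory **13**:5 (2019) 1145–1195 [cite: BrumerEtAl2019]
(PRINTED numbering and pages).

**What this file changes relative to `paramodular_of_galoisCertificate` (`GaloisCertificate.lean`).**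
There the form side enters through POSITED binders: a representation `ρf : Gal_ℚ → GL₄(ℤ₂)`, the pair
datum `PairCertificate ν ρA ρf` (`similitude₂` — `ρf` is `GSp(J)`-valued with the SAME multiplier `ν`
as `ρA` — and `residual_conj` — Step 1 of [Alg 2.4.1 p. 1155] up to frame), `hρf_unr` [Thm 4.3.4
(iii)] and `hρf` [Thm 4.3.4 (iv)].  Here:
* `ρf`, `similitude₂`, `hρf_unr`, `hρf` are DELIVERED by the cited named fact
  `BrumerEtAl2019.existsIntegralSymplecticGaloisRep_two_primeLevel` (`FormGaloisRepTwoAdic.lean`: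
  Thm 4.3.4 + Lemma 4.3.6 + Lemma 4.3.8 + Lemma 4.3.10, applied as on [p. 1188]) from the form data the
  templates already carry (`hcusp`, `hne`, `hfe`) plus the type-(G) numerics at one good prime (`hG`,
  [Prop 4.3.2 p. 1168]); the multiplier is PINNED to the `2`-adic cyclotomic character `χ₂`
  (`cyclotomicMultiplier`; [Thm 4.3.4 (ii), `k = 2`], and [(4.1.3) p. 1163] for `ρA`);
* Step 1 becomes the **residual identification datum** `ResidualIdentification N af bf ρA`: EVERY
  continuous `σ̄ : Gal_ℚ → Sp₄(𝔽₂)` unramified outside `2N`, with `charpoly σ̄(Frob_p) = X⁴Q_p(f,1/X) mod 2`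
  at the good odd primes and inertia at `N` acting through `1` or transvections, is conjugate to `ρ̄_A`
  by an element of `ι(S₆) = Sp₄(𝔽₂)`.  This is exactly what [Lemma 7.1.4 p. 1187] (and its analogues
  [§7.2 p. 1190, Thm 7.3.1 p. 1191]) establish: the fixed field of `ker σ̄` is the Galois closure of a
  quintic / sextic field unramified outside `{2, N}` with `ord_N(d) ≤ 1` [Prop 5.2.4 p. 1175], the
  Jones–Roberts tables list them all, the Frobenius data exclude all but `ℚ(A[2])`, and residual
  rigidity [(5.1.8) p. 1174] gives the conjugacy — in the cell's pipeline the block `residual` of the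
  Galois sub-certificate (`KernelResidualExclusion<N>.lean` decides the exclusions; the rigidity step is
  `ResidualRigidity.lean`).  It is a statement about `ρ̄_A` and the integers `a_p(f), b_p(f)` ONLY.
Absolute irreducibility of `σ̄` (the hypothesis of [Lemma 4.3.8 (b)]) is transported from the
certificate's `absIrreducible` along the conjugacy (`IsAbsIrreducible.of_conj`,
`CertificateConjTransfer.lean`), the fact then delivers `ρ_f : Gal_ℚ → GSp₄(ℤ₂)` with `ρ̄_f = σ̄`, and
`paramodular_of_galoisCertificate` finishes.  So the trust base of an instance built on
`paramodular_of_galoisCertificate_cited` is: the cited fact (Arthur-dependent through Mok 2014, flagged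
in its docstring), the Galois half `GaloisCertificate` and the datum `ResidualIdentification` (both
computed from the curve and the form's Euler factors; attested by the certificate, never Literature
facts), the frame/Euler binders, and the criterion [Thm 2.1.5] which is a tree theorem
(`traceEq_of_faltingsSerre_symplectic_holds`).  Design record: the cell's `DIVERGENCE.md` D-29.

## References
* [BPPTVY] Alg 2.4.1 p. 1155; Thm 2.1.5 p. 1150; (4.1.3) p. 1163; Prop 4.3.2 p. 1168; Thm 4.3.4 p. 1169;
  Lemma 4.3.8 p. 1171; Lemma 4.3.10 p. 1172; (5.1.8) p. 1174; Prop 5.2.4 p. 1175; Thm 7.1.3, Lemma 7.1.4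
  p. 1187; p. 1188. [cite: BrumerEtAl2019]
-/

noncomputable section

namespace Literature.NumberTheory.FaltingsSerre

open Matrix Equiv Field IsDedekindDomain Polynomial
open Literature.NumberTheory.GaloisRepresentations Literature.NumberTheory.FaltingsSerre.GSp4F2
  Literature.NumberTheory.Automorphic.Paramodular Literature.NumberTheory.Automorphic
  Literature.AlgebraicGeometry.Motives
open scoped NumberField

/-- The **`2`-adic cyclotomic multiplier** `γ ↦ χ₂(γ) ∈ ℤ₂`: the common similitude character of
`ρ_{A,2}` [(4.1.3) p. 1163: "with similitude character `χ_ℓ`"] and of `ρ_{f,2}` in weight `2`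
[Thm 4.3.4 (ii) p. 1169: `χ_ℓ^{2k-3}`], as a function `Gal_ℚ → ℤ_[2]` (the `ν` of the certificate
schemas). [cite: BrumerEtAl2019, (4.1.3) p. 1163; Thm 4.3.4 p. 1169] -/
def cyclotomicMultiplier : absoluteGaloisGroup ℚ → ℤ_[2] :=
  fun γ => ((GaloisRep.cyclotomicCharacter ℚ 2 γ : ℤ_[2]ˣ) : ℤ_[2])

/-- Unfolding lemma. [folklore] -/
theorem cyclotomicMultiplier_apply (γ : absoluteGaloisGroup ℚ) :
    cyclotomicMultiplier γ = ((GaloisRep.cyclotomicCharacter ℚ 2 γ : ℤ_[2]ˣ) : ℤ_[2]) :=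
  rfl

/-- **The residual identification datum** of level `N` for the form-side Euler data `(a_p, b_p)_p` and
the curve-side representation `ρA` (Step 1 of [Alg 2.4.1 p. 1155] as [Lemma 7.1.4 p. 1187] proves it):
every continuous `σ̄ : Gal_ℚ → GL₄(𝔽₂)` with values in `Sp₄(𝔽₂) = ι(S₆)`, unramified at the finite
places `v ∤ 2N`, with `charpoly σ̄(Frob_p) = (X⁴ - a_pX³ + b_pX² - pa_pX + p²) mod 2` at every prime
`p ∤ 2N`, and whose inertia at `N` acts through `1` or transvections [Prop 5.2.4 p. 1175], is conjugate
to `ρ̄_A = residual ρA` by an element of `ι(S₆)`.  A statement about `ρ̄_A` and integers only — in the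
cell's pipeline the block `residual` of the Galois sub-certificate (candidate fields from the
Jones–Roberts tables, exclusions `KernelResidualExclusion<N>.lean`, rigidity `ResidualRigidity.lean`);
attested by the certificate, never a Literature fact. [cite: BrumerEtAl2019, Lemma 7.1.4 p. 1187; Alg 2.2.3 p. 1151; Prop 5.2.4 p. 1175; (5.1.8) p. 1174] -/
def ResidualIdentification (N : ℕ) (a b : ℕ → ℤ) (ρA : FramedGaloisRep ℚ ℤ_[2] 4) : Prop :=
  ∀ σ : FramedGaloisRep ℚ (ZMod 2) 4,
    (∀ γ, σ γ ∈ iotaGL.range) →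
    (∀ v : HeightOneSpectrum (𝓞 ℚ), ((2 : ℕ) : 𝓞 ℚ) ∉ v.asIdeal → ((N : ℕ) : 𝓞 ℚ) ∉ v.asIdeal →
      σ.IsUnramifiedAt v) →
    (∀ p : ℕ, p.Prime → ¬ p ∣ N → p ≠ 2 →
      ∀ v : HeightOneSpectrum (𝓞 ℚ), ((p : ℕ) : 𝓞 ℚ) ∈ v.asIdeal →
        σ.HasFrobCharpolyAt v ((lPolynomialOfSurface p (a p) (b p)).reverse.map (Int.castRingHom (ZMod 2)))) →
    (∀ v : HeightOneSpectrum (𝓞 ℚ), ((N : ℕ) : 𝓞 ℚ) ∈ v.asIdeal →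
      ∀ 𝔓 ∈ v.primesAbove, ∀ τ ∈ 𝔓.inertia (absoluteGaloisGroup ℚ),
        σ τ = 1 ∨ IsTransvection ((σ τ : GL (Fin 4) (ZMod 2)) : Matrix (Fin 4) (Fin 4) (ZMod 2))) →
    ∃ π : Perm (Fin 6), ∀ γ, σ γ = iotaGL π * residual ρA.toMonoidHom γ * (iotaGL π)⁻¹

section Template

variable {N : ℕ} {T : Finset ℕ} {ρA : FramedGaloisRep ℚ ℤ_[2] 4}
  {A : AbelianVariety ℚ} {b : Module.Basis (Fin 4) ℚ_[2] (A.rationalTateModule 2)}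
  {f : Matrix (Fin 2) (Fin 2) ℂ → ℂ}

/-- For an odd prime level the places outside `placesOver (badPrimes N)` are those above neither `2`
nor `N`. [cite: BrumerEtAl2019, Thm 7.1.3 p. 1187] -/
theorem not_mem_placesOver_badPrimes_iff (hN : N.Prime) (v : HeightOneSpectrum (𝓞 ℚ)) :
    v ∉ placesOver (badPrimes N) ↔
      ((2 : ℕ) : 𝓞 ℚ) ∉ v.asIdeal ∧ ((N : ℕ) : 𝓞 ℚ) ∉ v.asIdeal := by
  rw [mem_placesOver, badPrimes_of_prime hN]
  simp only [Finset.mem_insert, Finset.mem_singleton, exists_eq_or_imp, exists_eq_left, not_or]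

/-- **`A` is paramodular of level `N` away from `N` — form side cited.**  `N` an odd prime; inputs:
the cited fact `h438` (`BrumerEtAl2019.existsIntegralSymplecticGaloisRep_two_primeLevel`: [Thm 4.3.4,
Lemmas 4.3.6, 4.3.8, 4.3.10; p. 1188]); the Galois half `G` of a certificate for `ρA` with the cyclotomic
multiplier [(4.1.3)]; the residual identification datum `hres` [Lemma 7.1.4]; the frame `hframe`
[(4.1.3)] and Euler data `hA` [(4.1.4)–(4.1.5)] of `A`; the check primes `hT` and the Step-5 trace
table `h5` [Alg 2.4.1 Step 5]; the form `hcusp`, `hne` with spinor Euler factors `hfe` [(4.2.18)] and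
type (G) at one good prime `hG` [Prop 4.3.2]; the hand check `h2` at `p = 2` [p. 1189].  Proof: the fact
gives `σ̄ = ρ̄^ss_{f,2}` over `𝔽₂`; `hres` conjugates it to `ρ̄_A` inside `ι(S₆)`; absolute
irreducibility passes from `ρ̄_A` (`G.absIrreducible`) to `σ̄` (`IsAbsIrreducible.of_conj`); the fact
then gives `ρ_f : Gal_ℚ → GSp₄(ℤ₂)` with multiplier `χ₂`, unramified outside `2N`, the right
Frobenius polynomials and `ρ̄_f = σ̄`; this is a `PairCertificate`, and `paramodular_of_galoisCertificate`
(criterion [Thm 2.1.5] = the tree theorem `traceEq_of_faltingsSerre_symplectic_holds`) concludes.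
CONDITIONAL on `h438` (Arthur-dependent through Mok 2014). [cite: BrumerEtAl2019, Thm 7.1.3 p. 1187; Lemma 7.1.4 p. 1187; p. 1188; Thm 4.3.4 p. 1169; Lemma 4.3.8 p. 1171; Alg 2.4.1 p. 1155; Thm 2.1.5 p. 1150] -/
theorem paramodular_of_galoisCertificate_cited [Fact N.Prime] (hN2 : N ≠ 2)
    (h438 : BrumerEtAl2019.existsIntegralSymplecticGaloisRep_two_primeLevel)
    (G : GaloisCertificate N T cyclotomicMultiplier ρA)
    (hframe : A.IsFrameOfTateRep 2 b (rationalize ρA)) (aA bA af bf : ℕ → ℤ)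
    (hres : ResidualIdentification N af bf ρA)
    (hA : ∀ p : ℕ, p.Prime → ¬ p ∣ N →
      A.HasGoodEulerFactorAt p ((lPolynomialOfSurface p (aA p) (bA p)).map (Int.castRingHom ℚ)))
    (hT : ∀ p ∈ T, p.Prime ∧ ¬ p ∣ N ∧ p ≠ 2) (h5 : ∀ p ∈ T, aA p = af p)
    (hcusp : IsParamodularCuspForm N 2 f) (hne : ∃ Z ∈ siegelUpperHalfSpace 2, f Z ≠ 0)
    (hfe : ∀ p : ℕ, p.Prime → ¬ p ∣ N →
      HasSpinorEulerFactorAt 2 p f ((lPolynomialOfSurface p (af p) (bf p)).map (Int.castRingHom ℂ)))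
    (hG : ∃ p₀ : ℕ, p₀.Prime ∧ ¬ p₀ ∣ N ∧
      ∀ z : ℂ, ((lPolynomialOfSurface p₀ (af p₀) (bf p₀)).map (Int.castRingHom ℂ)).IsRoot z →
        ‖z‖ = (Real.sqrt p₀)⁻¹)
    (h2 : aA 2 = af 2 ∧ bA 2 = bf 2) :
    IsParamodularAwayFrom A N f := by
  obtain ⟨σ, hSp, hunr, hchar, hin, hb⟩ := h438.elim hN2 hcusp hne af bf hfe hG
  obtain ⟨π, hπ⟩ := hres σ hSp hunr hchar hin
  have hirr : IsAbsIrreducible σ.toMonoidHom :=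
    IsAbsIrreducible.of_conj (residual ρA.toMonoidHom) σ.toMonoidHom (iotaGL π) (fun γ => hπ γ)
      G.absIrreducible
  obtain ⟨ρf, hsim, hρunr, hρchar, hred⟩ := hb hirr
  have P : PairCertificate cyclotomicMultiplier ρA ρf :=
    ⟨G.similitude, hsim, ⟨π, fun γ => by rw [hred γ]; exact hπ γ⟩⟩
  have hρf_unr : ∀ v ∉ placesOver (badPrimes N), ρf.IsUnramifiedAt v := fun v hv => by
    rw [not_mem_placesOver_badPrimes_iff (Fact.out : N.Prime)] at hv
    exact hρunr v hv.1 hv.2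
  exact paramodular_of_galoisCertificate G P hframe aA bA af bf hA hρf_unr hρchar hT h5 hcusp hne hfe
    (fun _ => h2)

end Template

end Literature.NumberTheory.FaltingsSerre

end
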